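import Mathlib

/-!
# SoloBlind E56 — the cell modulus is at least every individual congruence depth

Solo programme `solo-Langlands-blind`, own line (O1b), s118 (tower theory §13.11 addendum, rigorous part).  If a newform `F` in the cell has
`ℤ_p`-coefficients and `F ≡ E (mod p^d)`, then `t ↦ a₁(tF) mod p^d` is a SURJECTIVE ring homomorphism `ψ : T → ℤ/p^d` killing the
Eisenstein cell ideal `I`; hence `p^d ∣ #(T/I) = M′`, i.e. `μ ≥ d`: the cell invariant dominates every individual depth (it is NOT a sum of
depths).  Abstract form: `quotient_card_dvd_of_surjective`.
-/

set_option linter.dupNamespace false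

namespace Summit.Langlands.Langlands.Theorems.SoloBlindDepthLowerBound

variable {T : Type*} [CommRing T]

/-- If `ψ : T →+* ZMod m` is surjective and kills the ideal `I`, then `m ∣ #(T ⧸ I)`. -/
theorem quotient_card_dvd_of_surjective (I : Ideal T) (m : ℕ) (ψ : T →+* ZMod m) (hψ : Function.Surjective ψ)
    (hI : I ≤ RingHom.ker ψ) : m ∣ Nat.card (T ⧸ I) := by
  have h1 : Nat.card (T ⧸ RingHom.ker ψ) ∣ Nat.card (T ⧸ I) :=
    AddSubgroup.card_dvd_of_surjective ((Ideal.Quotient.factor hI : T ⧸ I →+* T ⧸ RingHom.ker ψ) : T ⧸ I →+ T ⧸ RingHom.ker ψ)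
      (Ideal.Quotient.factor_surjective hI)
  have h2 : Nat.card (T ⧸ RingHom.ker ψ) = m := by
    rw [Nat.card_congr (RingHom.quotientKerEquivOfSurjective hψ).toEquiv, Nat.card_zmod]
  rwa [h2] at h1

/-- Depth form: a surjection onto `ZMod (p ^ d)` killing `I` forces `p ^ d ∣ #(T ⧸ I)`. -/
theorem pow_dvd_card_quotient (I : Ideal T) (p d : ℕ) (ψ : T →+* ZMod (p ^ d)) (hψ : Function.Surjective ψ)
    (hI : I ≤ RingHom.ker ψ) : p ^ d ∣ Nat.card (T ⧸ I) :=
  quotient_card_dvd_of_surjective I (p ^ d) ψ hψ hI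

end Summit.Langlands.Langlands.Theorems.SoloBlindDepthLowerBound
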